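import Summits.Parity.BatemanHorn.Theorems.SelbergDelangeRigidityLSDRealSegmentTailsAux
import HarnessLib

/-!
# Route `SelbergDelangeRigidity`, crux `LSDRealSegment` (stmt-Parity-9770), line
# `product-anatomy-subcritical`: the tilted Rankin engine of `stub_tails`, global half (helper file)

For real `1 ≤ y < 2` and the weight `G(m) = y^{Ω(m)} (smoothPart z m)^σ` of the companion file
(`…TailsAux`: multiplicativity, `G(p) ≤ e y`, hypotheses (0.5)–(0.6) of Hall–Tenenbaum's Theorem 01), this file
runs the Euler-product bound (0.4): `Σ_{m ≤ N} G(m)/m ≤ ∏_{p ≤ N} (1 − G(p)/p)⁻¹ ≤ e^{C_y} (log N)^y`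
(Mertens' two theorems, upper halves: `Literature.NumberTheory.LFunctions.MertensBound.sum_inv_prime_le`,
`.sum_log_div_prime_le`, and `p^σ − 1 ≤ 2σ log p` for `σ log p ≤ 1`, which makes the bound UNIFORM in `z`), and
concludes with Theorem 01 (`Literature.NumberTheory.LFunctions.HallTenenbaum.theorem01`, PROVED):
`Σ_{m ≤ N} y^{Ω(m)} (smoothPart z m)^σ ≤ C_y N (log N)^{y−1}` for `N ≥ 2`, uniformly in `z ≥ 2`,
`0 ≤ σ ≤ min(σ₀, 1/log z)` (`tails_smoothTilt_sum_le`, the registered helper).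
-/

open Filter Finset Polynomial
open scoped BigOperators Topology Classical

namespace Summit.Parity.BatemanHorn.Cruxes.LSDRealSegment.ProductAnatomySubcritical

open Literature.NumberTheory.Sieve
open ArithmeticFunction (cardFactors)
noncomputable section

section Global

variable {y z σ : ℝ} {G : ℕ → ℝ}

/-- `(1 − u)⁻¹ ≤ exp(u + u²/(1 − r))` for `0 ≤ u ≤ r < 1`. [folklore] -/
theorem inv_one_sub_le_exp {u r : ℝ} (hur : u ≤ r) (hr : r < 1) :
    (1 - u)⁻¹ ≤ Real.exp (u + u ^ 2 / (1 - r)) := by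
  have h1u : 0 < 1 - u := by linarith
  have h1r : 0 < 1 - r := by linarith
  have e1 : (1 - u)⁻¹ = u / (1 - u) + 1 := by
    field_simp
    ring
  have e2 : u / (1 - u) = u + u ^ 2 / (1 - u) := by
    field_simp
    ring
  have h3 : u ^ 2 / (1 - u) ≤ u ^ 2 / (1 - r) := div_le_div_of_nonneg_left (sq_nonneg u) h1r (by linarith)
  calc (1 - u)⁻¹ = u / (1 - u) + 1 := e1
    _ ≤ Real.exp (u / (1 - u)) := Real.add_one_le_exp _
    _ ≤ Real.exp (u + u ^ 2 / (1 - r)) := by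
        rw [Real.exp_le_exp, e2]
        linarith

/-- `Σ_{p ≤ N} G(p)/p ≤ y log log N + 8y` (Mertens' two theorems, upper halves, and `p^σ − 1 ≤ 2σ log p`).
[folklore] -/
theorem tilt_sum_prime_div_le (hG : ∀ m, G m = y ^ cardFactors m * (smoothPart z m : ℝ) ^ σ) (hy : 1 ≤ y)
    (hy2 : y < 2) (hσ : 0 ≤ σ) (hσ₀ : σ ≤ (2 - y) / 8) (hσz : σ * Real.log z ≤ 1) (hz : 1 ≤ z) {N : ℕ}
    (hN : 2 ≤ N) : ∑ p ∈ Nat.primesLE N, G p / p ≤ y * Real.log (Real.log N) + 8 * y := by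
  have hy0 : 0 ≤ y := by linarith
  have h1 : ∑ p ∈ Nat.primesLE N, G p / p ≤
      ∑ p ∈ Nat.primesLE N, (y / p + if (p : ℝ) ≤ z then 2 * y * σ * (Real.log p / p) else 0) :=
    Finset.sum_le_sum fun p hp => tilt_prime_div_le_add hG hy0 hσ hσz (Nat.prime_of_mem_primesLE hp)
  rw [Finset.sum_add_distrib] at h1
  have h2 : ∑ p ∈ Nat.primesLE N, y / (p : ℝ) ≤ y * (Real.log (Real.log N) + 4) := by
    have e : ∑ p ∈ Nat.primesLE N, y / (p : ℝ) = y * ∑ p ∈ Nat.primesLE N, (1 : ℝ) / p := by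
      rw [Finset.mul_sum]
      exact Finset.sum_congr rfl fun p _ => by ring
    rw [e]
    exact mul_le_mul_of_nonneg_left (Literature.NumberTheory.LFunctions.MertensBound.sum_inv_prime_le N hN) hy0
  have h3 : ∑ p ∈ Nat.primesLE N, (if (p : ℝ) ≤ z then 2 * y * σ * (Real.log p / p) else 0) ≤
      2 * y * σ * (Real.log z + Real.log 4) := by
    rw [← Finset.sum_filter]
    have hsub : (Nat.primesLE N).filter (fun p : ℕ => (p : ℝ) ≤ z) ⊆ Nat.primesLE ⌊z⌋₊ := by
      intro p hp
      rw [Finset.mem_filter, Nat.mem_primesLE] at hp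
      rw [Nat.mem_primesLE]
      exact ⟨Nat.le_floor hp.2, hp.1.2⟩
    calc ∑ p ∈ (Nat.primesLE N).filter (fun p : ℕ => (p : ℝ) ≤ z), 2 * y * σ * (Real.log (p : ℝ) / (p : ℝ))
        ≤ ∑ p ∈ Nat.primesLE ⌊z⌋₊, 2 * y * σ * (Real.log (p : ℝ) / (p : ℝ)) :=
          Finset.sum_le_sum_of_subset_of_nonneg hsub fun (p : ℕ) _ _ => by
            have : 0 ≤ Real.log (p : ℝ) / (p : ℝ) := div_nonneg (Real.log_natCast_nonneg p) (Nat.cast_nonneg p)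
            positivity
      _ = 2 * y * σ * ∑ p ∈ Nat.primesLE ⌊z⌋₊, Real.log p / p := by rw [Finset.mul_sum]
      _ ≤ 2 * y * σ * (Real.log ⌊z⌋₊ + Real.log 4) :=
          mul_le_mul_of_nonneg_left (Literature.NumberTheory.LFunctions.MertensBound.sum_log_div_prime_le _)
            (by positivity)
      _ ≤ 2 * y * σ * (Real.log z + Real.log 4) := by
          gcongr
          · exact_mod_cast Nat.floor_pos.mpr hz
          · exact Nat.floor_le (by linarith)
  have h4 : 2 * y * σ * (Real.log z + Real.log 4) ≤ 4 * y := by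
    have hl4 : Real.log 4 ≤ 3 := by
      have := Real.log_le_sub_one_of_pos (show (0 : ℝ) < 4 by norm_num)
      linarith
    have hσ4 : σ * Real.log 4 ≤ 1 := by
      calc σ * Real.log 4 ≤ ((2 - y) / 8) * 3 :=
            mul_le_mul hσ₀ hl4 (Real.log_nonneg (by norm_num)) (by linarith)
        _ ≤ 1 := by linarith
    have e : 2 * y * σ * (Real.log z + Real.log 4) = 2 * y * (σ * Real.log z) + 2 * y * (σ * Real.log 4) := by
      ring
    rw [e]
    nlinarith
  linarith [h1, h2, h3, h4]

/-- **(0.4) for `G`**: `Σ_{m ≤ N} G(m)/m ≤ e^{8y + 4S/(1−r₀)} (log N)^y` for `N ≥ 2`, uniformly in `z ≥ 1` and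
admissible `σ` (`S = Σ n^{−3/2}`, `r₀ = y 2^{σ₀−1}`). [folklore] -/
theorem tilt_harmonic_le (hG : ∀ m, G m = y ^ cardFactors m * (smoothPart z m : ℝ) ^ σ) (hy : 1 ≤ y)
    (hy2 : y < 2) (hσ : 0 ≤ σ) (hσ₀ : σ ≤ (2 - y) / 8) (hσz : σ * Real.log z ≤ 1) (hz : 1 ≤ z) {N : ℕ}
    (hN : 2 ≤ N) :
    ∑ m ∈ Icc 1 N, G m / m ≤
      Real.exp (8 * y + 4 * (∑' n : ℕ, (n : ℝ) ^ (-(3 / 2 : ℝ))) / (1 - y * (2 : ℝ) ^ ((2 - y) / 8 - 1))) *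
        Real.log N ^ y := by
  set r₀ : ℝ := y * (2 : ℝ) ^ ((2 - y) / 8 - 1) with hr₀
  set S : ℝ := ∑' n : ℕ, (n : ℝ) ^ (-(3 / 2 : ℝ)) with hS
  have hy0 : 0 ≤ y := by linarith
  have hr1 : r₀ < 1 := r0_lt_one hy hy2
  have hu : ∀ p : ℕ, p.Prime → 0 ≤ G p / p ∧ G p / p ≤ y * (p : ℝ) ^ ((2 - y) / 8 - 1) ∧ G p / p ≤ r₀ := by
    intro p hp
    have hp0 : (0 : ℝ) < p := by exact_mod_cast hp.pos
    have h1 : G p / p ≤ y * (p : ℝ) ^ ((2 - y) / 8 - 1) := tilt_prime_div_le hG hy0 hσ hσ₀ hp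
    exact ⟨div_nonneg (tilt_nonneg hG hy0 p) hp0.le, h1, h1.trans (mul_rpow_prime_le_two hy0 (by linarith) hp)⟩
  have h04 := Literature.NumberTheory.LFunctions.HallTenenbaum.sum_div_le_prod_tsum (tilt_one hG)
    (fun m n h => tilt_mul_of_coprime hG h) (tilt_nonneg hG hy0)
    (fun p hp => (tilt_local_tsum hG hp (hu p hp).1 ((hu p hp).2.2.trans_lt hr1)).1) N
  refine h04.trans ?_
  have hfac : ∀ p ∈ Nat.primesLE N, ∑' ν : ℕ, G (p ^ ν) / (p : ℝ) ^ ν ≤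
      Real.exp (G p / p + (G p / p) ^ 2 / (1 - r₀)) := by
    intro p hp
    have hp' := Nat.prime_of_mem_primesLE hp
    obtain ⟨h0, -, hr⟩ := hu p hp'
    rw [(tilt_local_tsum hG hp' h0 (hr.trans_lt hr1)).2]
    exact inv_one_sub_le_exp hr hr1
  calc ∏ p ∈ Nat.primesLE N, ∑' ν : ℕ, G (p ^ ν) / (p : ℝ) ^ ν
      ≤ ∏ p ∈ Nat.primesLE N, Real.exp (G p / p + (G p / p) ^ 2 / (1 - r₀)) :=
        Finset.prod_le_prod (fun p _ => tsum_nonneg fun ν => div_nonneg (tilt_nonneg hG hy0 _) (by positivity)) hfac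
    _ = Real.exp (∑ p ∈ Nat.primesLE N, (G p / p + (G p / p) ^ 2 / (1 - r₀))) := by rw [Real.exp_sum]
    _ ≤ Real.exp (y * Real.log (Real.log N) + 8 * y + 4 * S / (1 - r₀)) := by
        rw [Real.exp_le_exp, Finset.sum_add_distrib]
        have hA := tilt_sum_prime_div_le hG hy hy2 hσ hσ₀ hσz hz hN
        have hB : ∑ p ∈ Nat.primesLE N, (G p / p) ^ 2 / (1 - r₀) ≤ 4 * S / (1 - r₀) := by
          rw [← Finset.sum_div]
          refine div_le_div_of_nonneg_right ?_ (by linarith)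
          calc ∑ p ∈ Nat.primesLE N, (G p / p) ^ 2 ≤ ∑ p ∈ Nat.primesLE N, 4 * (p : ℝ) ^ (-(3 / 2 : ℝ)) := by
                refine Finset.sum_le_sum fun p hp => ?_
                have hp' := Nat.prime_of_mem_primesLE hp
                obtain ⟨h0, hr, -⟩ := hu p hp'
                calc (G p / p) ^ 2 ≤ (y * (p : ℝ) ^ ((2 - y) / 8 - 1)) ^ 2 := pow_le_pow_left₀ h0 hr 2
                  _ ≤ 4 * (p : ℝ) ^ (-(3 / 2 : ℝ)) := rp_sq_le hy0 hy2.le (by linarith) hp'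
            _ = 4 * ∑ p ∈ Nat.primesLE N, (p : ℝ) ^ (-(3 / 2 : ℝ)) := by rw [Finset.mul_sum]
            _ ≤ 4 * S := by
                gcongr
                exact (Real.summable_nat_rpow.mpr (by norm_num)).sum_le_tsum _ fun n _ =>
                  Real.rpow_nonneg (Nat.cast_nonneg n) _
        linarith
    _ = Real.exp (8 * y + 4 * S / (1 - r₀)) * Real.log N ^ y := by
        have hN1 : (1 : ℝ) < N := by exact_mod_cast hN
        have hlogN : 0 < Real.log N := Real.log_pos hN1
        rw [Real.rpow_def_of_pos hlogN, ← Real.exp_add]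
        congr 1
        ring

/-- **The engine**: `Σ_{m ≤ N} G(m) ≤ C_y N (log N)^{y−1}` for `N ≥ 2`, uniformly in `z ≥ 1` and
`0 ≤ σ ≤ min((2−y)/8, 1/log z)` (Theorem 01 + (0.4)). [folklore] -/
theorem exists_tilt_sum_le (hy : 1 ≤ y) (hy2 : y < 2) :
    ∃ C : ℝ, ∀ (z σ : ℝ) (G : ℕ → ℝ), (∀ m, G m = y ^ cardFactors m * (smoothPart z m : ℝ) ^ σ) →
      1 ≤ z → 0 ≤ σ → σ ≤ (2 - y) / 8 → σ * Real.log z ≤ 1 →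
        ∀ N : ℕ, 2 ≤ N → ∑ m ∈ Icc 1 N, G m ≤ C * ((N : ℝ) * Real.log N ^ (y - 1)) := by
  set r₀ : ℝ := y * (2 : ℝ) ^ ((2 - y) / 8 - 1) with hr₀
  set T : ℝ := ∑' j : ℕ, ((j : ℝ) + 2) * r₀ ^ j with hT
  set S : ℝ := ∑' n : ℕ, (n : ℝ) ^ (-(3 / 2 : ℝ)) with hS
  set A : ℝ := Real.exp 1 * y * Real.log 4 with hA
  set B : ℝ := 16 * T * S with hB
  set E : ℝ := Real.exp (8 * y + 4 * S / (1 - r₀)) with hE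
  have hy0 : 0 ≤ y := by linarith
  refine ⟨(A + B + 1) * E, ?_⟩
  intro z σ G hG hz hσ hσ₀ hσz N hN
  have hN1 : (1 : ℝ) < N := by exact_mod_cast hN
  have hlogN : 0 < Real.log N := Real.log_pos hN1
  have h01 := Literature.NumberTheory.LFunctions.HallTenenbaum.theorem01 (f := G) (tilt_one hG)
    (fun m n h => tilt_mul_of_coprime hG h) (tilt_nonneg hG hy0) (A := A) (B := B)
    (fun w hw => tilt_hypA hG hy0 hσ hσz hw) (fun Y => tilt_hypB hG hy hy2 hσ hσ₀ Y) hN1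
  rw [Nat.floor_natCast] at h01
  have hM := tilt_harmonic_le hG hy hy2 hσ hσ₀ hσz hz hN
  have hAB : 0 ≤ (A + B + 1) * ((N : ℝ) / Real.log N) := by
    have hT0 : 0 ≤ T := tsum_nonneg fun j => by
      have : 0 ≤ r₀ := by positivity
      positivity
    have hS0 : 0 ≤ S := tsum_nonneg fun n => Real.rpow_nonneg (Nat.cast_nonneg n) _
    have : 0 ≤ Real.log 4 := Real.log_nonneg (by norm_num)
    positivity
  calc ∑ m ∈ Icc 1 N, G m ≤ (A + B + 1) * ((N : ℝ) / Real.log N) * ∑ m ∈ Icc 1 N, G m / m := h01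
    _ ≤ (A + B + 1) * ((N : ℝ) / Real.log N) * (E * Real.log N ^ y) := mul_le_mul_of_nonneg_left hM hAB
    _ = (A + B + 1) * E * ((N : ℝ) * (Real.log N ^ y / Real.log N)) := by
        field_simp
    _ = (A + B + 1) * E * ((N : ℝ) * Real.log N ^ (y - 1)) := by rw [Real.rpow_sub_one hlogN.ne']

end Global

/-! ### The registered helper -/

/-- **tails_smoothTilt_sum_le** (registered helper of `stub_tails`, line `product-anatomy-subcritical`): for real
`1 ≤ y < 2` there are `C` and `σ₀ > 0` such that, uniformly in `z ≥ 2` and `0 ≤ σ ≤ σ₀` with `σ log z ≤ 1`,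
`Σ_{1 ≤ m ≤ N} y^{Ω(m)} (smoothPart z m)^σ ≤ C N (log N)^{y−1}` for all `N ≥ 2` — the tilted Rankin moment of the
`z`-smooth part (Hall–Tenenbaum Theorem 01 for the multiplicative weight `y^{Ω} · (z-smooth part)^σ`; at `σ = 0`
the order of magnitude of `Σ_{m ≤ N} y^{Ω(m)}`). [folklore] -/
theorem tails_smoothTilt_sum_le : ∀ y : ℝ, 1 ≤ y → y < 2 → ∃ C σ₀ : ℝ, 0 < σ₀ ∧
    ∀ (z σ : ℝ) (N : ℕ), 2 ≤ z → 0 ≤ σ → σ ≤ σ₀ → σ * Real.log z ≤ 1 → 2 ≤ N →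
      (∑ m ∈ Icc 1 N, y ^ cardFactors m * (smoothPart z m : ℝ) ^ σ) ≤ C * ((N : ℝ) * Real.log N ^ (y - 1)) := by
  intro y hy hy2
  obtain ⟨C, hC⟩ := exists_tilt_sum_le hy hy2
  refine ⟨C, (2 - y) / 8, by linarith, ?_⟩
  intro z σ N hz hσ hσ₀ hσz hN
  exact hC z σ (fun m => y ^ cardFactors m * (smoothPart z m : ℝ) ^ σ) (fun _ => rfl) (by linarith) hσ hσ₀ hσz N hN



end

end Summit.Parity.BatemanHorn.Cruxes.LSDRealSegment.ProductAnatomySubcritical
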